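import Mathlib.GroupTheory.Perm.Basic
import Mathlib.Logic.Function.Basic
import Mathlib.Order.Interval.Finset.Nat
import Literature.Combinatorics.Enumerative.BruhatIntervalRookBoardsProofs
import Summits.ValiantsHypothesis.ValiantsHypothesis.Theses.PartialSorting
import HarnessLib

/-!
# Route PartialSorting — support item `CutWidthIdeal` (stmt-ValiantsHypothesis-13594)

**Claim settled (proved as stated).**
`Summit.ValiantsHypothesis.ValiantsHypothesis.Theses.PartialSorting.CutWidthIdeal`: for every `n`
and every `σ ∈ 𝔖ₙ`, writing `m = ⌊n/4⌋`, `x[i,j] = #{a ≤ i : x a ≥ j}` (the rank function of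
Björner–Brenti 2005, (2.2), here `Literature.Combinatorics.Enumerative.permRank`) and
`w⋆ a = n - 1 - a` if `a < m` or `a ≥ n - m`, `w⋆ a = a` otherwise (reverse the first `m` and the
last `m` positions into each other), we have
`(∀ i j, σ[i,j] ≤ w⋆[i,j]) ↔ ∀ t, d_t(σ) ≤ m`, where `d_t(σ) = #{a ≤ t : σ a > t}` is the cut
width of `σ` at `t`. In words: the lower Bruhat interval `[e, w⋆]` (rank criterion,
Björner–Brenti 2005, Thm 2.1.5) is exactly the set of permutations of cut-width `≤ ⌊n/4⌋`.

## Proof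

Everything is done with the `ℕ`-indexed north-east rank function
`NEₓ(I, J) = #{k | k < I ∧ J ≤ x k}` of `BruhatIntervalRookBoardsProofs` (`x[i,j] = NEₓ(i+1, j)`,
`d_t(σ) = NE_σ(t+1, t+1)`).

* The closed form behind the proof is `NE_{w⋆}(I, J) = min (I, n - J, m + (I - J)⁺)`; we only use
  the four regimes in which one of the three terms is attained:
  (C1) `I + J ≤ n` and (`I ≤ m` or `J ≤ m`): every row `k < I` has `w⋆ k ≥ J`, so
  `NE_{w⋆}(I, J) = I ≥ NE_σ(I, J)`;
  (C2) `I + J ≥ n` and (`m + J ≥ n` or `m + I ≥ n`): every row `k ≥ I` has `w⋆ k < J`, so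
  `NE_{w⋆}(I, J) = NE_{w⋆}(n, J) = n - J ≥ NE_σ(I, J)` (`w⋆` is an involution, hence a
  permutation);
  (C3a) `I ≤ J`, `m ≤ I`, `m + J ≤ n`: the rows `k < m` lie in the rectangle, so
  `NE_{w⋆}(I, J) ≥ m ≥ d_{I-1}(σ) = NE_σ(I, I) ≥ NE_σ(I, J)`;
  (C3b) `J ≤ I`, `m ≤ J`, `I + m ≤ n`: the rows `k < m` and `J ≤ k < I` lie in the rectangle, so
  `NE_{w⋆}(I, J) ≥ m + (I - J) ≥ NE_σ(I, I) + #{k < I : J ≤ σ k < I} ≥ NE_σ(I, J)`.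
  For `1 ≤ I ≤ n`, `J < n` the four regimes cover everything (`omega`, using `4m ≤ n`).
* Conversely `d_t(σ) = σ[t, t+1] ≤ w⋆[t, t+1] ≤ #{k < m} = m` for `t + 1 < n` (a row `k ≤ t`
  with `w⋆ k > t` must be one of the first `m`), and `d_{n-1}(σ) = 0`.

Brute force (not part of the proof): the equivalence and the closed form were re-checked for all
`σ ∈ 𝔖ₙ`, `n ≤ 8` (ideal sizes 1, 1, 1, 1, 20, 68, 232, 792, 25668).

References: A. Björner, F. Brenti, *Combinatorics of Coxeter Groups*, GTM 231 (2005), Thm 2.1.5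
and (2.2) [BjornerBrenti2005].
-/

namespace Summit.ValiantsHypothesis.Theorems

open Finset
open Literature.Combinatorics.Enumerative Literature.Combinatorics.Enumerative.Sjostrand2007

namespace PartialSortingCutWidthIdeal

variable {n : ℕ}

/-! ### The permutation `w⋆`

No definition is introduced: the lemmas take an arbitrary `w : Fin n → Fin n` together with the
hypothesis `hw` that its values are those of `w⋆_n` (`m = ⌊n/4⌋`): `w a = n - 1 - a` on the first
`m` and the last `m` positions, `w a = a` in between. The route's literal function
`fun a => if a < n/4 ∨ n - n/4 ≤ a then Fin.rev a else a` satisfies `hw` (`cutWidthIdeal_proof`). -/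

/-- `w⋆` is an involution. [folklore] -/
theorem wstar_wstar (w : Fin n → Fin n)
    (hw : ∀ a : Fin n, ((w a : Fin n) : ℕ) =
      if ((a : ℕ) < n / 4 ∨ n - n / 4 ≤ (a : ℕ)) then n - ((a : ℕ) + 1) else (a : ℕ))
    (a : Fin n) : w (w a) = a := by
  apply Fin.ext
  have ha := a.isLt
  rw [hw (w a), hw a]
  split_ifs <;> omega

/-! ### Counting lemmas -/

/-- The cut width `d_t(σ) = #{a ≤ t : σ a > t}` is the rank `NE_σ(t+1, t+1)`. [folklore] -/
theorem card_cut_eq_neRank (σ : Equiv.Perm (Fin n)) (t : Fin n) :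
    #{a : Fin n | a ≤ t ∧ t < σ a} =
      #{k : Fin n | (k : ℕ) < (t : ℕ) + 1 ∧ (t : ℕ) + 1 ≤ (σ k : ℕ)} := by
  congr 1
  ext a
  simp only [mem_filter, mem_univ, true_and, Fin.le_def, Fin.lt_def]
  omega

/-- `#{v : Fin n | J ≤ v < I} = I - J` for `I ≤ n`. [folklore] -/
theorem card_filter_Ico {I J : ℕ} (hI : I ≤ n) :
    #{v : Fin n | J ≤ (v : ℕ) ∧ (v : ℕ) < I} = I - J := by
  have h : (univ.filter (fun v : Fin n => J ≤ (v : ℕ) ∧ (v : ℕ) < I)).image Fin.val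
      = Finset.Ico J I := by
    ext v
    simp only [mem_image, mem_filter, mem_univ, true_and, Finset.mem_Ico]
    constructor
    · rintro ⟨a, ⟨h1, h2⟩, rfl⟩
      exact ⟨h1, h2⟩
    · rintro ⟨h1, h2⟩
      exact ⟨⟨v, lt_of_lt_of_le h2 hI⟩, ⟨h1, h2⟩, rfl⟩
  rw [← card_image_of_injective _ Fin.val_injective, h, Nat.card_Ico]

/-- Splitting a rank along the diagonal: `NE_σ(I, J) ≤ NE_σ(I, I) + (I - J)` for `I ≤ n`
(the rooks of the rows `< I` in the columns `≥ J` are those in the columns `≥ I` plus at most one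
per column `J ≤ c < I`). [folklore] -/
theorem neRank_le_diag_add (σ : Equiv.Perm (Fin n)) {I J : ℕ} (hI : I ≤ n) :
    #{k : Fin n | (k : ℕ) < I ∧ J ≤ (σ k : ℕ)} ≤
      #{k : Fin n | (k : ℕ) < I ∧ I ≤ (σ k : ℕ)} + (I - J) := by
  have hsub : (univ.filter (fun k : Fin n => (k : ℕ) < I ∧ J ≤ (σ k : ℕ))) ⊆
      univ.filter (fun k : Fin n => (k : ℕ) < I ∧ I ≤ (σ k : ℕ)) ∪
        univ.filter (fun k : Fin n => J ≤ (σ k : ℕ) ∧ (σ k : ℕ) < I) := by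
    intro a
    simp only [mem_filter, mem_univ, true_and, mem_union]
    omega
  have hwin : (univ.filter (fun k : Fin n => J ≤ (σ k : ℕ) ∧ (σ k : ℕ) < I)).card = I - J := by
    have h1 : (univ.filter (fun k : Fin n => J ≤ (σ k : ℕ) ∧ (σ k : ℕ) < I)).card
        = (univ.filter (fun v : Fin n => J ≤ (v : ℕ) ∧ (v : ℕ) < I)).card := by
      refine card_equiv σ ?_
      intro a
      simp
    rw [h1, card_filter_Ico hI]
  calc #{k : Fin n | (k : ℕ) < I ∧ J ≤ (σ k : ℕ)}
      ≤ (univ.filter (fun k : Fin n => (k : ℕ) < I ∧ I ≤ (σ k : ℕ)) ∪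
          univ.filter (fun k : Fin n => J ≤ (σ k : ℕ) ∧ (σ k : ℕ) < I)).card := card_le_card hsub
    _ ≤ #{k : Fin n | (k : ℕ) < I ∧ I ≤ (σ k : ℕ)} +
          (univ.filter (fun k : Fin n => J ≤ (σ k : ℕ) ∧ (σ k : ℕ) < I)).card := card_union_le _ _
    _ = #{k : Fin n | (k : ℕ) < I ∧ I ≤ (σ k : ℕ)} + (I - J) := by rw [hwin]

/-! ### The rank comparison `σ ≤ w⋆` from the cut-width bound -/

/-- If every cut width `d_t(σ) = NE_σ(t+1, t+1)` is at most `m = ⌊n/4⌋`, then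
`σ[i,j] ≤ w⋆[i,j]` for all `i, j` (in `NE` form). The four regimes (C1), (C2), (C3a), (C3b) of the
module docstring. [cite: BjornerBrenti2005, Thm 2.1.5] -/
theorem neRank_le_neRank_wstar (w : Fin n → Fin n)
    (hw : ∀ a : Fin n, ((w a : Fin n) : ℕ) =
      if ((a : ℕ) < n / 4 ∨ n - n / 4 ≤ (a : ℕ)) then n - ((a : ℕ) + 1) else (a : ℕ))
    (σ : Equiv.Perm (Fin n))
    (hd : ∀ t : Fin n, #{k : Fin n | (k : ℕ) < (t : ℕ) + 1 ∧ (t : ℕ) + 1 ≤ (σ k : ℕ)} ≤ n / 4)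
    (i j : Fin n) :
    #{k : Fin n | (k : ℕ) < (i : ℕ) + 1 ∧ (j : ℕ) ≤ (σ k : ℕ)} ≤
      #{k : Fin n | (k : ℕ) < (i : ℕ) + 1 ∧ (j : ℕ) ≤ (w k : ℕ)} := by
  have hi := i.isLt
  have hj := j.isLt
  have hdi := hd i
  rcases (by omega :
      ((i : ℕ) + 1 + j ≤ n ∧ ((i : ℕ) + 1 ≤ n / 4 ∨ (j : ℕ) ≤ n / 4)) ∨
      (n ≤ (i : ℕ) + 1 + j ∧ (n ≤ n / 4 + j ∨ n ≤ n / 4 + ((i : ℕ) + 1))) ∨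
      ((i : ℕ) + 1 ≤ j ∧ n / 4 ≤ (i : ℕ) + 1 ∧ n / 4 + j ≤ n) ∨
      ((j : ℕ) ≤ (i : ℕ) + 1 ∧ n / 4 ≤ (j : ℕ) ∧ (i : ℕ) + 1 + n / 4 ≤ n))
    with hc | hc | hc | hc
  · -- (C1): every row `k ≤ i` of `w⋆` lies in the columns `≥ j`
    refine card_le_card ?_
    intro a
    simp only [mem_filter, mem_univ, true_and]
    rintro ⟨ha, -⟩
    refine ⟨ha, ?_⟩
    have ha' := a.isLt
    rw [hw a]
    split_ifs <;> omega
  · -- (C2): every row `k > i` of `w⋆` lies in the columns `< j`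
    have hrow : #{k : Fin n | (k : ℕ) < (i : ℕ) + 1 ∧ (j : ℕ) ≤ (σ k : ℕ)} ≤
        #{k : Fin n | (k : ℕ) < n ∧ (j : ℕ) ≤ (σ k : ℕ)} := neRank_row_mono σ (by omega) j
    have hσn : #{k : Fin n | (k : ℕ) < n ∧ (j : ℕ) ≤ (σ k : ℕ)} = n - j := neRank_row_n σ hj.le
    have hwn : #{k : Fin n | (k : ℕ) < n ∧ (j : ℕ) ≤ (w k : ℕ)} = n - j :=
      neRank_row_n (Function.Involutive.toPerm w (wstar_wstar w hw)) hj.le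
    have heq : #{k : Fin n | (k : ℕ) < (i : ℕ) + 1 ∧ (j : ℕ) ≤ (w k : ℕ)} =
        #{k : Fin n | (k : ℕ) < n ∧ (j : ℕ) ≤ (w k : ℕ)} := by
      congr 1
      ext a
      simp only [mem_filter, mem_univ, true_and]
      constructor
      · rintro ⟨-, h⟩
        exact ⟨a.isLt, h⟩
      · rintro ⟨-, h⟩
        refine ⟨?_, h⟩
        by_contra hlt
        have ha' := a.isLt
        rw [hw a] at h
        split_ifs at h <;> omega
    omega
  · -- (C3a): the first `m` rows of `w⋆` lie in the rectangle; `σ[i,j] ≤ d_i(σ) ≤ m`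
    calc #{k : Fin n | (k : ℕ) < (i : ℕ) + 1 ∧ (j : ℕ) ≤ (σ k : ℕ)}
        ≤ #{k : Fin n | (k : ℕ) < (i : ℕ) + 1 ∧ (i : ℕ) + 1 ≤ (σ k : ℕ)} :=
          neRank_col_anti σ ((i : ℕ) + 1) hc.1
      _ ≤ n / 4 := hdi
      _ = #{k : Fin n | (k : ℕ) < n / 4} := (card_filter_row_lt (Nat.div_le_self n 4)).symm
      _ ≤ #{k : Fin n | (k : ℕ) < (i : ℕ) + 1 ∧ (j : ℕ) ≤ (w k : ℕ)} := by
          refine card_le_card ?_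
          intro a
          simp only [mem_filter, mem_univ, true_and]
          intro ha
          refine ⟨by omega, ?_⟩
          rw [hw a, if_pos (Or.inl ha)]
          omega
  · -- (C3b): the first `m` rows and the rows `j ≤ k ≤ i` of `w⋆` lie in the rectangle
    have hA : #{k : Fin n | (k : ℕ) < (i : ℕ) + 1 ∧ (j : ℕ) ≤ (σ k : ℕ)} ≤
        #{k : Fin n | (k : ℕ) < (i : ℕ) + 1 ∧ (i : ℕ) + 1 ≤ (σ k : ℕ)} + ((i : ℕ) + 1 - j) :=
      neRank_le_diag_add σ (by omega)
    have hB : (univ.filter (fun k : Fin n => (k : ℕ) < n / 4) ∪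
        univ.filter (fun k : Fin n => (j : ℕ) ≤ (k : ℕ) ∧ (k : ℕ) < (i : ℕ) + 1)).card =
          n / 4 + ((i : ℕ) + 1 - j) := by
      rw [card_union_of_disjoint, card_filter_row_lt (Nat.div_le_self n 4),
        card_filter_Ico (by omega)]
      rw [disjoint_filter]
      intro a _ h1 h2
      omega
    have hC : (univ.filter (fun k : Fin n => (k : ℕ) < n / 4) ∪
        univ.filter (fun k : Fin n => (j : ℕ) ≤ (k : ℕ) ∧ (k : ℕ) < (i : ℕ) + 1)).card ≤
          #{k : Fin n | (k : ℕ) < (i : ℕ) + 1 ∧ (j : ℕ) ≤ (w k : ℕ)} := by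
      refine card_le_card ?_
      intro a
      simp only [mem_union, mem_filter, mem_univ, true_and]
      rintro (ha | ⟨ha1, ha2⟩)
      · refine ⟨by omega, ?_⟩
        rw [hw a, if_pos (Or.inl ha)]
        omega
      · refine ⟨ha2, ?_⟩
        have ha' := a.isLt
        rw [hw a, if_neg (by omega)]
        exact ha1
    omega

/-- **The Bruhat ideal of `w⋆` is the set of permutations of cut-width `≤ ⌊n/4⌋`** (rank form,
with `permRank` and any `w` taking the values of `w⋆`): `(∀ i j, σ[i,j] ≤ w⋆[i,j]) ↔ ∀ t, d_t(σ) ≤ ⌊n/4⌋`.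
[cite: BjornerBrenti2005, Thm 2.1.5] -/
theorem bruhatLE_wstar_iff_cutWidth (w : Fin n → Fin n)
    (hw : ∀ a : Fin n, ((w a : Fin n) : ℕ) =
      if ((a : ℕ) < n / 4 ∨ n - n / 4 ≤ (a : ℕ)) then n - ((a : ℕ) + 1) else (a : ℕ))
    (σ : Equiv.Perm (Fin n)) :
    (∀ i j : Fin n, permRank σ i j ≤ permRank w i j) ↔
      ∀ t : Fin n, #{a : Fin n | a ≤ t ∧ t < σ a} ≤ n / 4 := by
  constructor
  · intro h t
    rw [card_cut_eq_neRank]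
    by_cases ht : (t : ℕ) + 1 < n
    · have h1 : #{k : Fin n | (k : ℕ) < (t : ℕ) + 1 ∧ (t : ℕ) + 1 ≤ (σ k : ℕ)} ≤
          #{k : Fin n | (k : ℕ) < (t : ℕ) + 1 ∧ (t : ℕ) + 1 ≤ (w k : ℕ)} := by
        have := h t ⟨(t : ℕ) + 1, ht⟩
        rw [permRank_eq_neRank, permRank_eq_neRank] at this
        exact this
      refine le_trans h1 ?_
      calc #{k : Fin n | (k : ℕ) < (t : ℕ) + 1 ∧ (t : ℕ) + 1 ≤ (w k : ℕ)}
          ≤ #{k : Fin n | (k : ℕ) < n / 4} := by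
            refine card_le_card ?_
            intro a
            simp only [mem_filter, mem_univ, true_and]
            rintro ⟨h1, h2⟩
            have ha' := a.isLt
            rw [hw a] at h2
            split_ifs at h2 <;> omega
        _ = n / 4 := card_filter_row_lt (Nat.div_le_self n 4)
    · have h0 : #{k : Fin n | (k : ℕ) < (t : ℕ) + 1 ∧ (t : ℕ) + 1 ≤ (σ k : ℕ)} = 0 := by
        simp only [card_eq_zero, filter_eq_empty_iff, mem_univ, true_implies, not_and, not_le]
        intro a _
        have := (σ a).isLt
        omega
      omega
  · intro hd i j
    rw [permRank_eq_neRank, permRank_eq_neRank]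
    refine neRank_le_neRank_wstar w hw σ (fun t => ?_) i j
    rw [← card_cut_eq_neRank]
    exact hd t

end PartialSortingCutWidthIdeal

open PartialSortingCutWidthIdeal in
/-- **Item `CutWidthIdeal` (stmt-ValiantsHypothesis-13594), proved as stated**: for all `n` and all
`σ ∈ 𝔖ₙ`, `σ ≤ w⋆_n` in Bruhat order (rank criterion `σ[i,j] ≤ w⋆[i,j]`, Björner–Brenti 2005,
Thm 2.1.5) iff every cut width `#{a ≤ t : σ a > t}` is at most `⌊n/4⌋`, where `w⋆_n` reverses the
first `⌊n/4⌋` and the last `⌊n/4⌋` positions into each other. [cite: BjornerBrenti2005, Thm 2.1.5] -/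
theorem cutWidthIdeal_proof :
    Summit.ValiantsHypothesis.ValiantsHypothesis.Theses.PartialSorting.CutWidthIdeal := by
  unfold Summit.ValiantsHypothesis.ValiantsHypothesis.Theses.PartialSorting.CutWidthIdeal
  intro n σ
  change (∀ i j : Fin n, permRank σ i j ≤
      permRank (fun a : Fin n => if ((a : ℕ) < n / 4 ∨ n - n / 4 ≤ (a : ℕ)) then Fin.rev a else a)
        i j) ↔ _
  refine bruhatLE_wstar_iff_cutWidth _ (fun a => ?_) σ
  split_ifs
  · exact Fin.val_rev a
  · rfl

end Summit.ValiantsHypothesis.Theorems
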